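import Summits.ValiantsHypothesis.ValiantsHypothesis.Theorems.LacunarySymmetroidMatrixDescartesCensusDoorA34MonotoneWindow

/-!
# `MatrixDescartes` census — three-letter pencils: NO PSD TIME ABOVE THE `S₁`-THRESHOLD when the top letter has a negative direction

HONEST FRAMING.  Object-search cell `pub-symmetroid`, route `LacunarySymmetroid`; beside the OPEN typed statement
`Theses.LacunarySymmetroid.DoorA34` (stmt-ValiantsHypothesis-19980), asserted nowhere.  Tail piece of `…CensusDoorA34MonotoneWindow` (the two
monotone windows of `G(t) = S₀ + t^a S₁ + t^b S₂`: PSD-ness inherited downward below `ν (b−a) t^b ≤ a`, upward above `b ≤ π (b−a) t^a`):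

* `trinomial_neg_of_large` — `s₀ + s₁ t^a + s₂ t^b < 0` for `s₂ < 0` and `t ≥ 1`, `t > (|s₀| + |s₁|)/(−s₂)`;
* **`not_posSemidef_above_threshold`** — `S₀ ⪰ 0`, `−S₁ − π S₀ ⪰ 0`, `S₂` with a negative direction `xᵀS₂x < 0`: at every `t > 0` with
  `b ≤ π (b − a) t^a`, `G(t)` is NOT positive semidefinite (upward inheritance would keep it PSD forever, against `xᵀG(t')x → −∞`);
  `psd_time_lt_threshold` — every PSD time satisfies `π (b−a) t^a < b`.

READING: in an all-semidefinite three-letter walk (`S₀ ≻ 0`; the Descartes word of a nine-row forces `S₁ ≺ 0` and `S₂` indefinite in the chamber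
`b > 3a`) all PD intervals lie below the `S₁`-threshold and, by the lower window, all boundary crossings but the first lie above the
`S₂`-threshold: eight of the nine roots of an all-semidefinite nine would have to sit strictly between the two thresholds.  Structure, not a bound;
`DoorA34` and the all-middle law stay OPEN; nothing on `ζ_sym(3,4)`, `MatrixDescartes` (stmt-ValiantsHypothesis-18050) or `VP ≠ VNP`.
[folklore] Elementary; no citation needed.
-/

-- `Summit.ValiantsHypothesis.ValiantsHypothesis.…` repeats a component by the D-0017 layout
-- (single-conjunct summit), which the `dupNamespace` linter flags; the name is mandated.
set_option linter.dupNamespace false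

namespace Summit.ValiantsHypothesis.ValiantsHypothesis.Theorems.LacunarySymmetroidMatrixDescartes.Census

open scoped Matrix

/-! ## Above the `S₁`-threshold the walk is permanently non-PSD when `S₂` has a negative direction

If `xᵀ S₂ x < 0` for some `x`, then `xᵀ G(t) x → −∞`; with the upward inheritance this gives: NO time `t` with
`b ≤ π (b − a) t^a` is a PSD time.  So every PD interval of the walk lies below the `S₁`-threshold, and (with the lower window) all
PSD-boundary crossings but the first lie in the window between the two thresholds. -/

/-- A trinomial with negative top coefficient is eventually negative: for `s₂ < 0`, `0 < a < b`, `t ≥ 1` and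
`t > (|s₀| + |s₁|) / (−s₂)` we have `s₀ + s₁ t^a + s₂ t^b < 0`. [folklore] -/
theorem trinomial_neg_of_large {s₀ s₁ s₂ : ℝ} (hs₂ : s₂ < 0) {a b : ℕ} (ha : 0 < a) (hab : a < b) {t : ℝ} (ht1 : 1 ≤ t)
    (ht : (|s₀| + |s₁|) / (-s₂) < t) : s₀ + s₁ * t ^ a + s₂ * t ^ b < 0 := by
  have ht0 : 0 < t := lt_of_lt_of_le one_pos ht1
  obtain ⟨k, hk⟩ : ∃ k, b = k + 1 := ⟨b - 1, by omega⟩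
  have hkb : a ≤ k := by omega
  have h1 : (1 : ℝ) ≤ t ^ k := one_le_pow₀ ht1
  have hta : t ^ a ≤ t ^ k := pow_le_pow_right₀ ht1 hkb
  have e0 : s₀ ≤ |s₀| * t ^ k := by
    calc s₀ ≤ |s₀| := le_abs_self _
      _ = |s₀| * 1 := (mul_one _).symm
      _ ≤ |s₀| * t ^ k := mul_le_mul_of_nonneg_left h1 (abs_nonneg _)
  have e1 : s₁ * t ^ a ≤ |s₁| * t ^ k := by
    calc s₁ * t ^ a ≤ |s₁| * t ^ a := mul_le_mul_of_nonneg_right (le_abs_self _) (pow_nonneg ht0.le _)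
      _ ≤ |s₁| * t ^ k := mul_le_mul_of_nonneg_left hta (abs_nonneg _)
  have hneg : 0 < -s₂ := by linarith
  have h2 : |s₀| + |s₁| < -s₂ * t := by
    have := (div_lt_iff₀ hneg).1 ht
    linarith [this]
  have htk : 0 < t ^ k := pow_pos ht0 _
  have h3 : (|s₀| + |s₁|) * t ^ k < (-s₂ * t) * t ^ k := mul_lt_mul_of_pos_right h2 htk
  have e2 : s₂ * t ^ b = -((-s₂ * t) * t ^ k) := by rw [hk, pow_succ]; ring
  rw [e2]
  nlinarith [e0, e1, h3]

/-- **Permanently non-PSD above the `S₁`-threshold.**  Let `S₀ ⪰ 0`, `−S₁ − π • S₀ ⪰ 0`, `0 < a < b`, and suppose `S₂` has a negative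
direction (`xᵀ S₂ x < 0`).  Then at every time `t > 0` with `b ≤ π (b − a) t^a` the matrix `G(t) = S₀ + t^a S₁ + t^b S₂` is NOT positive
semidefinite (else, by `posSemidef_of_posSemidef_earlier`, it would stay PSD at all later times, while `xᵀ G(t') x → −∞`). [folklore] -/
theorem not_posSemidef_above_threshold {n : Type*} [Fintype n] [DecidableEq n] (S₀ S₁ S₂ : Matrix n n ℝ)
    {a b : ℕ} (ha : 0 < a) (hab : a < b) {π : ℝ} (h0 : S₀.PosSemidef) (h1 : (-S₁ - π • S₀).PosSemidef)
    {x : n → ℝ} (hx : x ⬝ᵥ (S₂ *ᵥ x) < 0) {t : ℝ} (ht : 0 < t) (hthr : (b : ℝ) ≤ π * ((b : ℝ) - a) * t ^ a) :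
    ¬ (S₀ + t ^ a • S₁ + t ^ b • S₂).PosSemidef := by
  intro hG
  set s₀ := x ⬝ᵥ (S₀ *ᵥ x) with hs₀
  set s₁ := x ⬝ᵥ (S₁ *ᵥ x) with hs₁
  set s₂ := x ⬝ᵥ (S₂ *ᵥ x) with hs₂
  set t' := max (max t 1) ((|s₀| + |s₁|) / (-s₂)) + 1 with ht'
  have ht't : t < t' := by
    have : t ≤ max (max t 1) ((|s₀| + |s₁|) / (-s₂)) := (le_max_left _ _).trans (le_max_left _ _)
    linarith
  have ht'1 : 1 ≤ t' := by
    have : (1 : ℝ) ≤ max (max t 1) ((|s₀| + |s₁|) / (-s₂)) := (le_max_right _ _).trans (le_max_left _ _)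
    linarith
  have ht'q : (|s₀| + |s₁|) / (-s₂) < t' := by
    have : (|s₀| + |s₁|) / (-s₂) ≤ max (max t 1) ((|s₀| + |s₁|) / (-s₂)) := le_max_right _ _
    linarith
  have hG' := posSemidef_of_posSemidef_earlier S₀ S₁ S₂ ha hab h0 h1 ht ht't hthr hG
  have hq : x ⬝ᵥ ((S₀ + t' ^ a • S₁ + t' ^ b • S₂) *ᵥ x) = s₀ + s₁ * t' ^ a + s₂ * t' ^ b := by
    simp only [Matrix.add_mulVec, Matrix.smul_mulVec, dotProduct_add, dotProduct_smul, smul_eq_mul, hs₀, hs₁, hs₂]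
    ring
  have hneg := trinomial_neg_of_large hx ha hab ht'1 ht'q
  have hnn : 0 ≤ x ⬝ᵥ ((S₀ + t' ^ a • S₁ + t' ^ b • S₂) *ᵥ x) := by
    have := hG'.dotProduct_mulVec_nonneg x
    rwa [star_trivial] at this
  rw [hq] at hnn
  linarith

/-- **All PSD times lie below the `S₁`-threshold** (contrapositive packaging): under the same hypotheses, a PSD time `t > 0` satisfies
`π (b − a) t^a < b`. [folklore] -/
theorem psd_time_lt_threshold {n : Type*} [Fintype n] [DecidableEq n] (S₀ S₁ S₂ : Matrix n n ℝ)
    {a b : ℕ} (ha : 0 < a) (hab : a < b) {π : ℝ} (h0 : S₀.PosSemidef) (h1 : (-S₁ - π • S₀).PosSemidef)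
    {x : n → ℝ} (hx : x ⬝ᵥ (S₂ *ᵥ x) < 0) {t : ℝ} (ht : 0 < t) (hG : (S₀ + t ^ a • S₁ + t ^ b • S₂).PosSemidef) :
    π * ((b : ℝ) - a) * t ^ a < b := by
  by_contra h
  push Not at h
  exact not_posSemidef_above_threshold S₀ S₁ S₂ ha hab h0 h1 hx ht h hG

/-! ## The crossing-direction law at a root (appended)

At a root `r` with kernel vector `κ` (`G(r) κ = 0`) the derivative of the Rayleigh value `κᵀ G(t) κ` at `t = r` — whose sign decides whether
the vanishing eigenvalue crosses upward or downward — is computed by the kernel equation from ONE end letter: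
`r · κᵀ G′(r) κ = (b − a) r^b κᵀS₂κ − a κᵀS₀κ = −(b − a) r^a κᵀS₁κ − b κᵀS₀κ`.  So for `S₀ = 1`: an UPcrossing needs
`r^b σ₂(κ) > a/(b−a)` and `r^a σ₋₁(κ) > b/(b−a)` (`σ₋₁ = κᵀ(−S₁)κ/|κ|²`), a DOWNcrossing the reverse inequalities — the pointwise
sharpening of the two windows (there `σ₂ ≤ ν`, `σ₋₁ ≥ π`). -/

/-- **Crossing-direction identity (top-letter form).**  If `κᵀ(S₀ + r^a S₁ + r^b S₂)κ = 0` then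
`a r^a κᵀS₁κ + b r^b κᵀS₂κ = (b − a) r^b κᵀS₂κ − a κᵀS₀κ` (the left side is `r · d/dt (κᵀG(t)κ)` at `t = r`). [folklore] -/
theorem crossing_direction_top {s₀ s₁ s₂ r : ℝ} {a b : ℕ} (hker : s₀ + r ^ a * s₁ + r ^ b * s₂ = 0) :
    (a : ℝ) * (r ^ a * s₁) + (b : ℝ) * (r ^ b * s₂) = ((b : ℝ) - a) * (r ^ b * s₂) - a * s₀ := by
  have h : r ^ a * s₁ = -s₀ - r ^ b * s₂ := by linarith
  rw [h]; ring

/-- **Crossing-direction identity (middle-letter form).**  Under the same kernel equation,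
`a r^a κᵀS₁κ + b r^b κᵀS₂κ = −(b − a) r^a κᵀS₁κ − b κᵀS₀κ`. [folklore] -/
theorem crossing_direction_middle {s₀ s₁ s₂ r : ℝ} {a b : ℕ} (hker : s₀ + r ^ a * s₁ + r ^ b * s₂ = 0) :
    (a : ℝ) * (r ^ a * s₁) + (b : ℝ) * (r ^ b * s₂) = -(((b : ℝ) - a) * (r ^ a * s₁)) - b * s₀ := by
  have h : r ^ b * s₂ = -s₀ - r ^ a * s₁ := by linarith
  rw [h]; ring

/-- The Rayleigh value of the pencil along a fixed vector, and its kernel equation in coordinates: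
`κ ⬝ (G(r) κ) = κᵀS₀κ + r^a κᵀS₁κ + r^b κᵀS₂κ`. [folklore] -/
theorem dotProduct_threeLetter_mulVec {n : Type*} [Fintype n] (S₀ S₁ S₂ : Matrix n n ℝ) (a b : ℕ) (r : ℝ) (κ : n → ℝ) :
    κ ⬝ᵥ ((S₀ + r ^ a • S₁ + r ^ b • S₂) *ᵥ κ)
      = κ ⬝ᵥ (S₀ *ᵥ κ) + r ^ a * (κ ⬝ᵥ (S₁ *ᵥ κ)) + r ^ b * (κ ⬝ᵥ (S₂ *ᵥ κ)) := by
  simp only [Matrix.add_mulVec, Matrix.smul_mulVec, dotProduct_add, dotProduct_smul, smul_eq_mul]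

/-- **UPCROSSING LAW.**  Let `κ` be a kernel vector of `G(r) = S₀ + r^aS₁ + r^bS₂` (`G(r) κ = 0`) at which the Rayleigh derivative is
positive, `a r^a κᵀS₁κ + b r^b κᵀS₂κ > 0` (the vanishing eigenvalue crosses UPWARD; `r > 0`).  Then
`(b − a) r^b κᵀS₂κ > a κᵀS₀κ` and `−(b − a) r^a κᵀS₁κ > b κᵀS₀κ`.  (With `S₀ = 1`: `r^b σ₂(κ) > a/(b−a)` and `r^a σ₋₁(κ) > b/(b−a)`;
the window theorems are the versions with `σ₂ ≤ ν`, `σ₋₁ ≥ π`.) [folklore] -/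
theorem upcrossing_law {n : Type*} [Fintype n] (S₀ S₁ S₂ : Matrix n n ℝ) (a b : ℕ) (r : ℝ) (κ : n → ℝ)
    (hker : (S₀ + r ^ a • S₁ + r ^ b • S₂) *ᵥ κ = 0)
    (hup : 0 < (a : ℝ) * (r ^ a * (κ ⬝ᵥ (S₁ *ᵥ κ))) + (b : ℝ) * (r ^ b * (κ ⬝ᵥ (S₂ *ᵥ κ)))) :
    (a : ℝ) * (κ ⬝ᵥ (S₀ *ᵥ κ)) < ((b : ℝ) - a) * (r ^ b * (κ ⬝ᵥ (S₂ *ᵥ κ))) ∧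
      (b : ℝ) * (κ ⬝ᵥ (S₀ *ᵥ κ)) < -(((b : ℝ) - a) * (r ^ a * (κ ⬝ᵥ (S₁ *ᵥ κ)))) := by
  have h0 : κ ⬝ᵥ (S₀ *ᵥ κ) + r ^ a * (κ ⬝ᵥ (S₁ *ᵥ κ)) + r ^ b * (κ ⬝ᵥ (S₂ *ᵥ κ)) = 0 := by
    rw [← dotProduct_threeLetter_mulVec, hker, dotProduct_zero]
  have h1 := crossing_direction_top (a := a) (b := b) h0
  have h2 := crossing_direction_middle (a := a) (b := b) h0
  constructor <;> linarith

/-- **DOWNCROSSING LAW** (the reverse inequalities when the Rayleigh derivative is negative). [folklore] -/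
theorem downcrossing_law {n : Type*} [Fintype n] (S₀ S₁ S₂ : Matrix n n ℝ) (a b : ℕ) (r : ℝ) (κ : n → ℝ)
    (hker : (S₀ + r ^ a • S₁ + r ^ b • S₂) *ᵥ κ = 0)
    (hdown : (a : ℝ) * (r ^ a * (κ ⬝ᵥ (S₁ *ᵥ κ))) + (b : ℝ) * (r ^ b * (κ ⬝ᵥ (S₂ *ᵥ κ))) < 0) :
    ((b : ℝ) - a) * (r ^ b * (κ ⬝ᵥ (S₂ *ᵥ κ))) < (a : ℝ) * (κ ⬝ᵥ (S₀ *ᵥ κ)) ∧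
      -(((b : ℝ) - a) * (r ^ a * (κ ⬝ᵥ (S₁ *ᵥ κ)))) < (b : ℝ) * (κ ⬝ᵥ (S₀ *ᵥ κ)) := by
  have h0 : κ ⬝ᵥ (S₀ *ᵥ κ) + r ^ a * (κ ⬝ᵥ (S₁ *ᵥ κ)) + r ^ b * (κ ⬝ᵥ (S₂ *ᵥ κ)) = 0 := by
    rw [← dotProduct_threeLetter_mulVec, hker, dotProduct_zero]
  have h1 := crossing_direction_top (a := a) (b := b) h0
  have h2 := crossing_direction_middle (a := a) (b := b) h0
  constructor <;> linarith

end Summit.ValiantsHypothesis.ValiantsHypothesis.Theorems.LacunarySymmetroidMatrixDescartes.Census
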